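import Literature.NumberTheory.LFunctions.TwistedPrimeSumTail
import Literature.NumberTheory.LFunctions.ZetaScaleTwistedSum
import HarnessLib

/-!
# The prime tail of Matomäki–Radziwiłł's Lemma 2 from a zero-free region for `ζ` ALONE

Topic `Literature/NumberTheory/LFunctions`.  Everything in this file is PROVED; there are no
definitions and no named facts.

`TwistedPrimeSumTail.lean` proves, from a Vinogradov–Korobov region for ALL Dirichlet `L`-functions
(`HasVKZeroFreeRegion c T₀`; theorems `…_of_vk`), the quantitative content of the step
"`|∑_{exp((log x)^{2/3+ε}) ≤ p ≤ x} p^{-1-2iα}| = O(1)` … by the zero-free region for the Riemann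
zeta-function" of K. Matomäki, M. Radziwiłł, *Multiplicative functions in short intervals*, Ann. of
Math. 183 (2016), proof of Lemma 2, and the resulting lower bound for the tail of the twist distance
`𝔻(1, n^{it}; Y)² − 𝔻(1, n^{it}; exp((log X)^θ) − 1)² ≥ log log Y − θ log log X − 6`.  Only the
principal character (indeed only `q = 1`) enters those statements.  This file re-proves them from the
analytic input the source names — a zero-free region for `ζ` alone — in the scale-wise form of
`ZetaScaleTwistedSum.lean` (the inline hypothesis `hZ`: for every `η > 2/3` and all large `X`,
`ζ₁(s) ≠ 0` on `|Im s| ≤ 3X`, `Re s ≥ 1 − (log X)^{-η}`; supplied there from any `ζ`-only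
Vinogradov–Korobov region, from `HasVKZeroFreeRegion`, or from Ford's `zeta_bound_ford`), the proofs
being those of `TwistedPrimeSumTail.lean` verbatim with the principal-character twisted prime number
theorem `ZetaScale.twisted_sum_estimate_one_of_scale` in place of `TwistedVonMangoldt.twisted_sum_estimate_of_vk`:

* `ZetaScale.norm_primeCharSum_le_one_of_scale` — for large `X`, `q ≤ (log X)^A`, the principal
  character `χ₀` mod `q`, `1 ≤ |t| ≤ X`, `Y ≤ X`: `‖∑_{exp((log X)^θ) ≤ p ≤ Y} χ₀(p) p^{-1-it}‖ ≤ 4`;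
* `ZetaScale.sum_one_sub_re_twist_ge_of_scale` — `∑_{exp((log X)^θ) ≤ p ≤ Y} (1 − Re p^{it})/p
  ≥ log log Y − θ log log X − 6` (`1 ≤ |t| ≤ X`, `exp((log X)^θ) ≤ Y ≤ X`);
* `ZetaScale.pretentiousDistSq_one_twist_tail_ge_of_scale` — the same as
  `𝔻(1, n^{it}; Y)² − 𝔻(1, n^{it}; exp((log X)^θ) − 1)² ≥ log log Y − θ log log X − 6`, the input of
  `MatomakiRadziwill2016_lemma3_of_GS_tail` (`MatomakiRadziwillLemma3VK.lean`).

## References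
* K. Matomäki, M. Radziwiłł, Ann. of Math. (2) 183 (2016), 1015–1056, Lemma 2 and its proof.
  [cite: MatomakiRadziwillAnnals2016, Lemma 2]
* H. L. Montgomery, R. C. Vaughan, *Multiplicative Number Theory I*, Theorem 6.6, Lemma 12.1. [MontgomeryVaughan2007]
-/

noncomputable section

open MeasureTheory Set intervalIntegral Complex Filter Topology

namespace Literature.NumberTheory.LFunctions

namespace ZetaScale

open Literature.NumberTheory.Sieve.Lichtman2020.PrimeCharSum TwistedVonMangoldt MRT2015DistLowerBound
open TwistedPrimeSumTail

set_option maxHeartbeats 1600000 in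
/-- **Twisted prime sums over the Vinogradov–Korobov window are bounded, principal character, from a
zero-free region for `ζ` alone** (scale-wise form `hZ`).  Let `A > 0`, `θ > 2/3`.  For all large `X`,
all `q ≤ (log X)^A`, the principal character `χ₀` mod `q`, all `1 ≤ |t| ≤ X` and all `Y ≤ X`,
`‖∑_{exp((log X)^θ) ≤ p ≤ Y} χ₀(p) p^{-1-it}‖ ≤ 4`.
Proof: that of `TwistedPrimeSumTail.norm_primeCharSum_le_of_vk` verbatim (Abel summation with
`f(u) = 1/(u log u)` against `D(u) = ∑_{p ≤ u} χ₀(p) log p · p^{-it} = u^{1-it}/(1-it) + O(u(log X)^{-2})`,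
now by `ZetaScale.twisted_sum_estimate_one_of_scale`; the main term `∫ u^{-it} du/(u log u)` has norm
`≤ 3` for `|t| ≥ 1`). [cite: MatomakiRadziwillAnnals2016, Lemma 2 (proof)] -/
theorem norm_primeCharSum_le_one_of_scale
    (hZ : ∀ η : ℝ, 2 / 3 < η → ∀ᶠ X : ℝ in atTop, ∀ s : ℂ, |s.im| ≤ 3 * X →
      1 - Real.log X ^ (-η) ≤ s.re → riemannZeta₁ s ≠ 0)
    {A θ : ℝ} (hA : 0 < A) (hθ : 2 / 3 < θ) :
    ∀ᶠ X : ℝ in atTop, ∀ (q : ℕ) [NeZero q], (q : ℝ) ≤ Real.log X ^ A →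
      ∀ (χ : DirichletCharacter ℂ q), χ = 1 → ∀ (t : ℝ), 1 ≤ |t| → |t| ≤ X → ∀ Y : ℝ, Y ≤ X →
        ‖∑ p ∈ (Finset.Icc ⌈Real.exp (Real.log X ^ θ)⌉₊ ⌊Y⌋₊).filter Nat.Prime,
            χ (p : ZMod q) * (p : ℂ) ^ (-(1 + (t : ℂ) * I))‖ ≤ 4 := by
  have hθ0 : 0 < θ := by linarith
  filter_upwards [twisted_sum_estimate_one_of_scale hZ hA hθ (K := 2) (by norm_num),
    Real.tendsto_log_atTop.eventually_ge_atTop (16 : ℝ),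
    ((tendsto_rpow_atTop hθ0).comp Real.tendsto_log_atTop).eventually_ge_atTop (4 : ℝ),
    eventually_mul_log_rpow_le_exp 16 2 (show (0 : ℝ) < 1 / 4 by norm_num) hθ0,
    eventually_gt_atTop (0 : ℝ)] with X htw hℓ16 hℓθ hEψ hX0
  intro q _ hqA χ hχ1 t ht1 ht Y hYX
  set ℓ : ℝ := Real.log X with hℓdef
  have hℓ1 : 1 ≤ ℓ := by linarith
  have hℓ0 : 0 < ℓ := by linarith
  have hℓθ' : (4 : ℝ) ≤ ℓ ^ θ := by simpa using hℓθ
  set P : ℝ := Real.exp (ℓ ^ θ) with hPdef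
  have hP0 : 0 < P := Real.exp_pos _
  -- the empty range
  rcases lt_or_ge Y P with hYP | hPY
  · have hempty : (Finset.Icc ⌈P⌉₊ ⌊Y⌋₊).filter Nat.Prime = ∅ := by
      have hlt : ⌊Y⌋₊ < ⌈P⌉₊ := by
        rcases le_or_gt 0 Y with hY0 | hY0
        · have h1 : (⌊Y⌋₊ : ℝ) ≤ Y := Nat.floor_le hY0
          have h2 : P ≤ ⌈P⌉₊ := Nat.le_ceil P
          exact_mod_cast (show (⌊Y⌋₊ : ℝ) < ⌈P⌉₊ by linarith)
        · rw [Nat.floor_of_nonpos hY0.le]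
          exact Nat.ceil_pos.2 hP0
      rw [Finset.Icc_eq_empty_of_lt hlt, Finset.filter_empty]
    rw [hempty, Finset.sum_empty, norm_zero]
    norm_num
  have hY0 : 0 ≤ Y := hP0.le.trans hPY
  -- parameters
  set ε : ℝ := ℓ ^ (-(2 : ℝ)) with hεdef
  have hε0 : 0 < ε := Real.rpow_pos_of_pos hℓ0 _
  have hεval : ε = (ℓ ^ 2)⁻¹ := by
    rw [hεdef, Real.rpow_neg hℓ0.le, Real.rpow_two]
  have hεψ : 16 * Real.exp (-(ℓ ^ θ / 4)) ≤ ε := by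
    have hprod : ℓ ^ (2 : ℝ) * ε = 1 := by
      rw [hεdef, ← Real.rpow_add hℓ0, add_neg_cancel, Real.rpow_zero]
    have h1 := mul_le_mul_of_nonneg_right hEψ (show 0 ≤ Real.exp (-(ℓ ^ θ / 4)) * ε by positivity)
    have h2 : 16 * ℓ ^ (2 : ℝ) * (Real.exp (-(ℓ ^ θ / 4)) * ε) =
        16 * Real.exp (-(ℓ ^ θ / 4)) * (ℓ ^ (2 : ℝ) * ε) := by ring
    have h3 : Real.exp (1 / 4 * ℓ ^ θ) * (Real.exp (-(ℓ ^ θ / 4)) * ε) = ε := by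
      rw [← mul_assoc, ← Real.exp_add, show 1 / 4 * ℓ ^ θ + -(ℓ ^ θ / 4) = 0 by ring, Real.exp_zero,
        one_mul]
    rw [h2, hprod, mul_one, h3] at h1
    exact h1
  -- `P`, `n`, `m`
  have he4 : (5 : ℝ) ≤ Real.exp 4 := by have := Real.add_one_le_exp (4 : ℝ); linarith
  have hexpP : Real.exp 4 ≤ P := Real.exp_le_exp.2 hℓθ'
  have hP5 : 5 ≤ P := he4.trans hexpP
  rw [sum_primes_eq_sum_weight_mul χ t hP0 Y]
  set n : ℕ := ⌈P⌉₊ - 1 with hndef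
  set m : ℕ := ⌊Y⌋₊ with hmdef
  have hn1 : 1 ≤ ⌈P⌉₊ := Nat.ceil_pos.2 hP0
  have hncast : (n : ℝ) = ⌈P⌉₊ - 1 := by rw [hndef, Nat.cast_sub hn1, Nat.cast_one]
  have hnP : P - 1 ≤ n := by rw [hncast]; linarith [Nat.le_ceil P]
  have hn_ge : Real.exp (ℓ ^ θ) / 2 ≤ n := by rw [← hPdef]; linarith
  have hn2 : (2 : ℝ) ≤ n := by linarith
  have hn0 : (0 : ℝ) < n := by linarith
  have hn1' : (1 : ℝ) < n := by linarith
  have hmX : (m : ℝ) ≤ X := (Nat.floor_le hY0).trans hYX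
  have hnm : n ≤ m := by
    have h1 : (⌈P⌉₊ : ℝ) < P + 1 := Nat.ceil_lt_add_one hP0.le
    have h2 : Y < (⌊Y⌋₊ : ℝ) + 1 := Nat.lt_floor_add_one Y
    have h3 : (⌈P⌉₊ : ℝ) < (⌊Y⌋₊ : ℝ) + 2 := by linarith
    have h4 : ⌈P⌉₊ < ⌊Y⌋₊ + 2 := by exact_mod_cast h3
    omega
  have hnmR : (n : ℝ) ≤ m := by exact_mod_cast hnm
  have hm0 : (0 : ℝ) < m := by linarith
  -- logarithms
  have hlog2 : Real.log 2 ≤ 1 := by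
    have := Real.log_le_sub_one_of_pos (show (0 : ℝ) < 2 by norm_num); linarith
  have hlogn : ℓ ^ θ / 2 ≤ Real.log n := by
    have h1 : Real.log (Real.exp (ℓ ^ θ) / 2) = ℓ ^ θ - Real.log 2 := by
      rw [Real.log_div (Real.exp_pos _).ne' (by norm_num), Real.log_exp]
    have h2 : Real.log (Real.exp (ℓ ^ θ) / 2) ≤ Real.log n := Real.log_le_log (by positivity) hn_ge
    linarith
  have hlogn1 : 1 ≤ Real.log n := by linarith
  have hlogn0 : 0 < Real.log n := by linarith
  have hlogm : Real.log n ≤ Real.log m := Real.log_le_log hn0 hnmR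
  have hlogm0 : 0 < Real.log m := by linarith
  have hlogmn : Real.log ((m : ℝ) / n) ≤ ℓ := by
    have h1 : (m : ℝ) / n ≤ X := by
      rw [div_le_iff₀ hn0]
      calc (m : ℝ) ≤ X := hmX
        _ = X * 1 := (mul_one X).symm
        _ ≤ X * n := mul_le_mul_of_nonneg_left hn1'.le hX0.le
    exact Real.log_le_log (by positivity) h1
  -- the main term `M(u) = δ u^{r+1}/(r+1)`, `r = -it`, and its derivative `M'(u) = δ u^r`
  set r : ℂ := -((t : ℂ) * I) with hrdef
  have hr1 : r + 1 = 1 - t * I := by rw [hrdef]; ring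
  have hrne : r ≠ -1 := by
    intro h
    have := congrArg Complex.re h
    simp [hrdef] at this
  set M : ℝ → ℂ := fun u => delta χ * ((u : ℂ) ^ (r + 1) / (r + 1)) with hMdef
  set M' : ℝ → ℂ := fun u => delta χ * (u : ℂ) ^ r with hM'def
  have hMderiv : ∀ u ∈ uIcc (n : ℝ) m, HasDerivAt M (M' u) u := by
    intro u hu
    rw [uIcc_of_le hnmR] at hu
    have hu0 : u ≠ 0 := by linarith [hu.1]
    exact (hasDerivAt_ofReal_cpow_const' hu0 hrne).const_mul (delta χ)
  have hMeq : ∀ u : ℝ, M u = delta χ * (u : ℂ) ^ (1 - t * I) / (1 - t * I) := by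
    intro u
    simp only [hMdef, hr1, mul_div_assoc]
  -- `‖D(u) − M(u)‖ ≤ 2εu` on `[n, m]`
  have hDM : ∀ u : ℝ, (n : ℝ) ≤ u → u ≤ m →
      ‖∑ k ∈ Finset.Icc 0 ⌊u⌋₊, primeCoeff χ t k - M u‖ ≤ 2 * ε * u := by
    intro u hu1 hu2
    have hulo : Real.exp (ℓ ^ θ) / 2 ≤ u := hn_ge.trans hu1
    have huX : u ≤ X := hu2.trans hmX
    rw [hMeq]
    exact norm_sum_primeCoeff_sub_le χ t (htw q hqA χ hχ1 t ht u hulo huX)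
      (psi_sub_theta_le_of_scale hℓθ' hεψ hulo)
  -- Abel summation
  have hf_diff : ∀ u ∈ Set.Icc (n : ℝ) m, DifferentiableAt ℝ (fun u : ℝ ↦ ((weight u : ℝ) : ℂ)) u :=
    fun u hu ↦ (hasDerivAt_weightC (by linarith [hu.1] : 1 < u)).differentiableAt
  have hderiv : ∀ u ∈ Set.Icc (n : ℝ) m, deriv (fun u : ℝ ↦ ((weight u : ℝ) : ℂ)) u =
      (((-(Real.log u + 1) / (u * Real.log u) ^ 2 : ℝ)) : ℂ) :=
    fun u hu ↦ (hasDerivAt_weightC (by linarith [hu.1] : 1 < u)).deriv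
  have hcontR : ContinuousOn (fun u : ℝ ↦ -(Real.log u + 1) / (u * Real.log u) ^ 2) (Set.Icc (n : ℝ) m) := by
    have hlogc : ContinuousOn Real.log (Set.Icc (n : ℝ) m) :=
      Real.continuousOn_log.mono fun u hu ↦ by
        simp only [Set.mem_compl_iff, Set.mem_singleton_iff]
        exact (by linarith [hu.1] : (0 : ℝ) < u).ne'
    refine ContinuousOn.div ((hlogc.add continuousOn_const).neg) ((continuousOn_id.mul hlogc).pow 2) ?_
    intro u hu
    have hu1 : 1 < u := by linarith [hu.1]
    exact pow_ne_zero 2 (mul_ne_zero (by linarith) (Real.log_pos hu1).ne')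
  have hcontC : ContinuousOn (fun u : ℝ ↦ (((-(Real.log u + 1) / (u * Real.log u) ^ 2 : ℝ)) : ℂ))
      (Set.Icc (n : ℝ) m) := Complex.continuous_ofReal.comp_continuousOn hcontR
  have hf_int : IntegrableOn (deriv (fun u : ℝ ↦ ((weight u : ℝ) : ℂ))) (Set.Icc (n : ℝ) m) :=
    (hcontC.integrableOn_Icc).congr_fun (fun u hu ↦ (hderiv u hu).symm) measurableSet_Icc
  have hAbel : ∑ k ∈ Finset.Ioc n m, ((weight k : ℝ) : ℂ) * primeCoeff χ t k =
      ((weight m : ℝ) : ℂ) * (∑ k ∈ Finset.Icc 0 m, primeCoeff χ t k) -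
        ((weight n : ℝ) : ℂ) * (∑ k ∈ Finset.Icc 0 n, primeCoeff χ t k) -
        ∫ u in Set.Ioc (n : ℝ) m, deriv (fun u : ℝ ↦ ((weight u : ℝ) : ℂ)) u *
          ∑ k ∈ Finset.Icc 0 ⌊u⌋₊, primeCoeff χ t k :=
    sum_mul_eq_sub_sub_integral_mul' (primeCoeff χ t) hnm hf_diff hf_int
  -- the Abel integral as an interval integral of `w' · D`
  set w' : ℝ → ℂ := fun u ↦ (((-(Real.log u + 1) / (u * Real.log u) ^ 2 : ℝ)) : ℂ) with hw'def
  set D : ℝ → ℂ := fun u ↦ ∑ k ∈ Finset.Icc 0 ⌊u⌋₊, primeCoeff χ t k with hDdef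
  have hIoc : ∫ u in Set.Ioc (n : ℝ) m, deriv (fun u : ℝ ↦ ((weight u : ℝ) : ℂ)) u *
      ∑ k ∈ Finset.Icc 0 ⌊u⌋₊, primeCoeff χ t k = ∫ u in (n : ℝ)..m, w' u * D u := by
    rw [intervalIntegral.integral_of_le hnmR]
    refine setIntegral_congr_fun measurableSet_Ioc fun u hu => ?_
    simp only [hw'def, hDdef]
    rw [hderiv u ⟨hu.1.le, hu.2⟩]
  -- integrability of `w' · D` and `w' · M`, `M'`
  have hwD_int : IntervalIntegrable (fun u => w' u * D u) volume n m := by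
    rw [intervalIntegrable_iff_integrableOn_Icc_of_le hnmR]
    exact integrableOn_mul_sum_Icc (primeCoeff χ t) (Nat.cast_nonneg n) hcontC.integrableOn_Icc
  have hMcont : ContinuousOn M (uIcc (n : ℝ) m) :=
    continuousOn_const.mul ((continuousOn_ofReal_cpow_const hn0 hnmR (r + 1)).div_const (r + 1))
  have hM'cont : ContinuousOn M' (uIcc (n : ℝ) m) :=
    continuousOn_const.mul (continuousOn_ofReal_cpow_const hn0 hnmR r)
  have hw'cont : ContinuousOn w' (uIcc (n : ℝ) m) := by rw [uIcc_of_le hnmR]; exact hcontC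
  have hwM_int : IntervalIntegrable (fun u => w' u * M u) volume n m :=
    (hw'cont.mul hMcont).intervalIntegrable
  have hw'_int : IntervalIntegrable w' volume n m := hw'cont.intervalIntegrable
  have hM'_int : IntervalIntegrable M' volume n m := hM'cont.intervalIntegrable
  -- integration by parts for the main term
  have hwderiv : ∀ u ∈ uIcc (n : ℝ) m, HasDerivAt (fun u : ℝ ↦ ((weight u : ℝ) : ℂ)) (w' u) u := by
    intro u hu
    rw [uIcc_of_le hnmR] at hu
    exact hasDerivAt_weightC (by linarith [hu.1] : 1 < u)
  have hIBP : ∫ u in (n : ℝ)..m, ((weight u : ℝ) : ℂ) * M' u =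
      ((weight m : ℝ) : ℂ) * M m - ((weight n : ℝ) : ℂ) * M n -
        ∫ u in (n : ℝ)..m, w' u * M u :=
    intervalIntegral.integral_mul_deriv_eq_deriv_mul hwderiv hMderiv hw'_int hM'_int
  -- the decomposition `S = Main + Err`
  set Main : ℂ := ∫ u in (n : ℝ)..m, ((weight u : ℝ) : ℂ) * M' u with hMain
  set Err : ℂ := ((weight m : ℝ) : ℂ) * (D m - M m) - ((weight n : ℝ) : ℂ) * (D n - M n) -
      ∫ u in (n : ℝ)..m, w' u * (D u - M u) with hErr
  have hsub_int : ∫ u in (n : ℝ)..m, w' u * (D u - M u) =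
      (∫ u in (n : ℝ)..m, w' u * D u) - ∫ u in (n : ℝ)..m, w' u * M u := by
    rw [← intervalIntegral.integral_sub hwD_int hwM_int]
    refine intervalIntegral.integral_congr fun u _ => ?_
    simp only [mul_sub]
  have hDm : D m = ∑ k ∈ Finset.Icc 0 m, primeCoeff χ t k := by
    simp only [hDdef, Nat.floor_natCast]
  have hDn : D n = ∑ k ∈ Finset.Icc 0 n, primeCoeff χ t k := by
    simp only [hDdef, Nat.floor_natCast]
  have hdecomp : ∑ k ∈ Finset.Ioc n m, ((weight k : ℝ) : ℂ) * primeCoeff χ t k = Main + Err := by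
    rw [hAbel, hIoc, hIBP, hErr, hsub_int, hDm, hDn]
    ring
  -- size of the error
  have hDMm : ‖D m - M m‖ ≤ 2 * ε * m := by
    rw [hDm]; have := hDM m hnmR le_rfl; rwa [Nat.floor_natCast] at this
  have hDMn : ‖D n - M n‖ ≤ 2 * ε * n := by
    rw [hDn]; have := hDM n le_rfl hnmR; rwa [Nat.floor_natCast] at this
  have hwm : ‖((weight m : ℝ) : ℂ) * (D m - M m)‖ ≤ 2 * ε := by
    rw [norm_mul, Complex.norm_real, Real.norm_eq_abs, weight, abs_of_pos (by positivity)]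
    calc ((m : ℝ) * Real.log m)⁻¹ * ‖D m - M m‖
        ≤ ((m : ℝ) * Real.log m)⁻¹ * (2 * ε * m) := mul_le_mul_of_nonneg_left hDMm (by positivity)
      _ = 2 * ε / Real.log m := by field_simp
      _ ≤ 2 * ε / 1 := div_le_div_of_nonneg_left (by positivity) one_pos (hlogn1.trans hlogm)
      _ = 2 * ε := div_one _
  have hwn : ‖((weight n : ℝ) : ℂ) * (D n - M n)‖ ≤ 2 * ε := by
    rw [norm_mul, Complex.norm_real, Real.norm_eq_abs, weight, abs_of_pos (by positivity)]
    calc ((n : ℝ) * Real.log n)⁻¹ * ‖D n - M n‖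
        ≤ ((n : ℝ) * Real.log n)⁻¹ * (2 * ε * n) := mul_le_mul_of_nonneg_left hDMn (by positivity)
      _ = 2 * ε / Real.log n := by field_simp
      _ ≤ 2 * ε / 1 := div_le_div_of_nonneg_left (by positivity) one_pos hlogn1
      _ = 2 * ε := div_one _
  set g : ℝ → ℝ := fun u ↦ 4 * ε / Real.log n * u⁻¹ with hgdef
  have hgcont : ContinuousOn g (Set.Icc (n : ℝ) m) := by
    refine ContinuousOn.mul continuousOn_const (continuousOn_inv₀.comp continuousOn_id fun u hu ↦ ?_)
    exact (by linarith [hu.1] : (0 : ℝ) < u).ne'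
  have hgi : IntervalIntegrable g volume n m := by
    rw [intervalIntegrable_iff_integrableOn_Icc_of_le hnmR]; exact hgcont.integrableOn_Icc
  have hbound : ∀ᵐ u : ℝ ∂volume, u ∈ Set.Ioc (n : ℝ) m → ‖w' u * (D u - M u)‖ ≤ g u := by
    refine ae_of_all _ fun u hu ↦ ?_
    have hu1 : (n : ℝ) < u := hu.1
    have hu2 : u ≤ m := hu.2
    have hu0 : 0 < u := by linarith
    have hlogu : Real.log n ≤ Real.log u := Real.log_le_log hn0 hu1.le
    have hlogu1 : 1 ≤ Real.log u := hlogn1.trans hlogu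
    rw [norm_mul]
    have h1 := norm_deriv_weight_le (by linarith : 1 < u) hlogu1
    have h2 := hDM u hu1.le hu2
    calc ‖w' u‖ * ‖D u - M u‖ ≤ 2 / (u ^ 2 * Real.log u) * (2 * ε * u) :=
          mul_le_mul h1 h2 (norm_nonneg _) (by positivity)
      _ = 4 * ε / Real.log u * u⁻¹ := by field_simp; ring
      _ ≤ 4 * ε / Real.log n * u⁻¹ := by gcongr
      _ = g u := rfl
  have hint : ‖∫ u in (n : ℝ)..m, w' u * (D u - M u)‖ ≤ 4 * ε * ℓ := by
    refine (intervalIntegral.norm_integral_le_of_norm_le hnmR hbound hgi).trans ?_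
    rw [hgdef, intervalIntegral.integral_const_mul, integral_inv_of_pos hn0 hm0]
    calc 4 * ε / Real.log n * Real.log ((m : ℝ) / n) ≤ 4 * ε / Real.log n * ℓ :=
          mul_le_mul_of_nonneg_left hlogmn (by positivity)
      _ ≤ 4 * ε / 1 * ℓ := by gcongr
      _ = 4 * ε * ℓ := by rw [div_one]
  have hErr_le : ‖Err‖ ≤ 1 := by
    have h1 : ‖Err‖ ≤ 2 * ε + 2 * ε + 4 * ε * ℓ := by
      calc ‖Err‖ ≤ ‖((weight m : ℝ) : ℂ) * (D m - M m) - ((weight n : ℝ) : ℂ) * (D n - M n)‖ +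
            ‖∫ u in (n : ℝ)..m, w' u * (D u - M u)‖ := norm_sub_le _ _
        _ ≤ (‖((weight m : ℝ) : ℂ) * (D m - M m)‖ + ‖((weight n : ℝ) : ℂ) * (D n - M n)‖) +
            ‖∫ u in (n : ℝ)..m, w' u * (D u - M u)‖ := by gcongr; exact norm_sub_le _ _
        _ ≤ (2 * ε + 2 * ε) + 4 * ε * ℓ := add_le_add (add_le_add hwm hwn) hint
    -- `ε = ℓ^{-2}`, `ℓ ≥ 16`
    have h2 : 4 * ε + 4 * ε * ℓ ≤ 1 := by
      rw [hεval]
      have hℓ2 : 0 < ℓ ^ 2 := by positivity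
      rw [show 4 * (ℓ ^ 2)⁻¹ + 4 * (ℓ ^ 2)⁻¹ * ℓ = (4 + 4 * ℓ) / ℓ ^ 2 by field_simp,
        div_le_one hℓ2]
      nlinarith
    linarith
  -- the norm of the main term
  have hMain_le : ‖Main‖ ≤ 3 := by
    have hen : Real.exp 1 ≤ (n : ℝ) := by
      have h := Real.exp_le_exp.2 hlogn1
      rwa [Real.exp_log hn0] at h
    by_cases hχ : χ = 1
    · have hδ : delta χ = 1 := by simp [delta, hχ]
      have e : Main = ∫ u in (n : ℝ)..m, ((weight u : ℝ) : ℂ) * (u : ℂ) ^ (-((t : ℂ) * I)) := by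
        simp only [hMain, hM'def, hδ, one_mul, hrdef]
      rw [e]
      exact norm_integral_weight_mul_cpow_le ht1 hen hnmR
    · have hδ : delta χ = 0 := by simp [delta, hχ]
      have e : Main = 0 := by
        simp only [hMain, hM'def, hδ, zero_mul, mul_zero, intervalIntegral.integral_zero]
      rw [e, norm_zero]; norm_num
  -- conclusion
  rw [hdecomp]
  calc ‖Main + Err‖ ≤ ‖Main‖ + ‖Err‖ := norm_add_le _ _
    _ ≤ 3 + 1 := add_le_add hMain_le hErr_le
    _ = 4 := by norm_num

set_option maxHeartbeats 800000 in
/-- **Matomäki–Radziwiłł's Lemma 2, localised to the Vinogradov–Korobov window, for twists, from a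
zero-free region for `ζ` alone** (scale-wise form `hZ`).  Let `θ > 2/3`.  For all large `X`, all
`1 ≤ |t| ≤ X` and all `exp((log X)^θ) ≤ Y ≤ X`,
`∑_{exp((log X)^θ) ≤ p ≤ Y} (1 - Re p^{it})/p ≥ log log Y - θ log log X - 6`
(Mertens and `norm_primeCharSum_le_one_of_scale` with the trivial character mod `1`; the proof of
`TwistedPrimeSumTail.sum_one_sub_re_twist_ge_of_vk` verbatim).
[cite: MatomakiRadziwillAnnals2016, Lemma 2 (proof)] -/
theorem sum_one_sub_re_twist_ge_of_scale
    (hZ : ∀ η : ℝ, 2 / 3 < η → ∀ᶠ X : ℝ in atTop, ∀ s : ℂ, |s.im| ≤ 3 * X →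
      1 - Real.log X ^ (-η) ≤ s.re → riemannZeta₁ s ≠ 0)
    {θ : ℝ} (hθ : 2 / 3 < θ) :
    ∀ᶠ X : ℝ in atTop, ∀ t : ℝ, 1 ≤ |t| → |t| ≤ X → ∀ Y : ℝ, Real.exp (Real.log X ^ θ) ≤ Y → Y ≤ X →
      Real.log (Real.log Y) - θ * Real.log (Real.log X) - 6 ≤
        ∑ p ∈ (Finset.Icc ⌈Real.exp (Real.log X ^ θ)⌉₊ ⌊Y⌋₊).filter Nat.Prime,
          (1 - ((p : ℂ) ^ ((t : ℂ) * I)).re) / p := by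
  have hθ0 : 0 < θ := by linarith
  filter_upwards [norm_primeCharSum_le_one_of_scale hZ (A := 1) one_pos hθ,
    Real.tendsto_log_atTop.eventually_ge_atTop (1 : ℝ),
    ((tendsto_rpow_atTop hθ0).comp Real.tendsto_log_atTop).eventually_ge_atTop (4 : ℝ)] with X hS hℓ1 hℓθ
  intro t ht1 ht Y hPY hYX
  set ℓ : ℝ := Real.log X with hℓdef
  have hℓ0 : 0 < ℓ := by linarith
  have hℓθ' : (4 : ℝ) ≤ ℓ ^ θ := by simpa using hℓθ
  set P : ℝ := Real.exp (ℓ ^ θ) with hPdef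
  have hP0 : 0 < P := Real.exp_pos _
  have hlogP : Real.log P = ℓ ^ θ := Real.log_exp _
  have hP2 : (2 : ℝ) ≤ P := by
    have h4 : Real.exp 4 ≤ P := Real.exp_le_exp.2 hℓθ'
    have : (5 : ℝ) ≤ Real.exp 4 := by have := Real.add_one_le_exp (4 : ℝ); linarith
    linarith
  -- Mertens
  have hM := MertensBound.loglog_sub_loglog_le_sum_inv_prime_Icc hP2 hPY
  have hloglogP : Real.log (Real.log P) = θ * Real.log ℓ := by
    rw [hlogP, Real.log_rpow hℓ0]
  have h6 : 6 / Real.log P ≤ 2 := by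
    rw [hlogP, div_le_iff₀ (by linarith)]; linarith
  -- the oscillating part, with the trivial character mod `1` and `t ↦ -t`
  have hq : ((1 : ℕ) : ℝ) ≤ Real.log X ^ (1 : ℝ) := by simpa using hℓ1
  have hS' := hS 1 hq (1 : DirichletCharacter ℂ 1) rfl (-t) (by simpa using ht1) (by simpa using ht) Y hYX
  set S : ℂ := ∑ p ∈ (Finset.Icc ⌈P⌉₊ ⌊Y⌋₊).filter Nat.Prime,
    (1 : DirichletCharacter ℂ 1) (p : ZMod 1) * (p : ℂ) ^ (-(1 + ((-t : ℝ) : ℂ) * I)) with hSdef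
  have hSre : S.re = ∑ p ∈ (Finset.Icc ⌈P⌉₊ ⌊Y⌋₊).filter Nat.Prime, (1 : ℝ) / p * ((p : ℂ) ^ ((t : ℂ) * I)).re := by
    rw [hSdef, Complex.re_sum]
    refine Finset.sum_congr rfl fun p hp => ?_
    have hpp : p.Prime := (Finset.mem_filter.1 hp).2
    rw [re_term_eq (1 : DirichletCharacter ℂ 1) t hpp, dirichletCharacter_one_mod_one_apply, one_mul]
  have hSre_le : S.re ≤ 4 := (Complex.re_le_norm S).trans hS'
  -- assemble
  have hsplit : ∑ p ∈ (Finset.Icc ⌈P⌉₊ ⌊Y⌋₊).filter Nat.Prime, (1 - ((p : ℂ) ^ ((t : ℂ) * I)).re) / p =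
      (∑ p ∈ (Finset.Icc ⌈P⌉₊ ⌊Y⌋₊).filter Nat.Prime, (1 : ℝ) / p) - S.re := by
    rw [hSre, ← Finset.sum_sub_distrib]
    refine Finset.sum_congr rfl fun p _ => ?_
    ring
  rw [hsplit]
  linarith

open Literature.NumberTheory.Sieve (pretentiousDistSq minPretentiousDistSq) in
/-- **The tail of the twist distance over the Vinogradov–Korobov window, from a zero-free region for
`ζ` alone** (scale-wise form `hZ`): for large `X`, `1 ≤ |t| ≤ X`, `exp((log X)^θ) ≤ Y ≤ X`,
`log log Y - θ log log X - 6 ≤ 𝔻(1, n^{it}; Y)² - 𝔻(1, n^{it}; exp((log X)^θ) - 1)²`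
(the proof of `TwistedPrimeSumTail.pretentiousDistSq_one_twist_tail_ge_of_vk` verbatim).  This is the
hypothesis `hT` of `MatomakiRadziwill2016_lemma3_of_GS_tail` at `θ = 7/10`.
[cite: MatomakiRadziwillAnnals2016, Lemma 2 (proof)] -/
theorem pretentiousDistSq_one_twist_tail_ge_of_scale
    (hZ : ∀ η : ℝ, 2 / 3 < η → ∀ᶠ X : ℝ in atTop, ∀ s : ℂ, |s.im| ≤ 3 * X →
      1 - Real.log X ^ (-η) ≤ s.re → riemannZeta₁ s ≠ 0)
    {θ : ℝ} (hθ : 2 / 3 < θ) :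
    ∀ᶠ X : ℝ in atTop, ∀ t : ℝ, 1 ≤ |t| → |t| ≤ X → ∀ Y : ℝ, Real.exp (Real.log X ^ θ) ≤ Y → Y ≤ X →
      Real.log (Real.log Y) - θ * Real.log (Real.log X) - 6 ≤
        pretentiousDistSq 1 (fun n : ℕ => (n : ℂ) ^ ((t : ℂ) * I)) Y -
          pretentiousDistSq 1 (fun n : ℕ => (n : ℂ) ^ ((t : ℂ) * I)) (Real.exp (Real.log X ^ θ) - 1) := by
  filter_upwards [sum_one_sub_re_twist_ge_of_scale hZ hθ,
    Real.tendsto_log_atTop.eventually_ge_atTop (0 : ℝ)] with X hX hℓ0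
  intro t ht1 ht Y hPY hYX
  refine (hX t ht1 ht Y hPY hYX).trans ?_
  set P : ℝ := Real.exp (Real.log X ^ θ) with hPdef
  have hP1 : 1 ≤ P := by
    have : (1 : ℝ) ≤ Real.exp 0 := by rw [Real.exp_zero]
    exact this.trans (Real.exp_le_exp.2 (Real.rpow_nonneg hℓ0 θ))
  have hP10 : 0 ≤ P - 1 := by linarith
  set f : ℕ → ℝ := fun p => (1 - ((p : ℂ) ^ ((t : ℂ) * I)).re) / p with hf
  have hτ : ∀ n : ℕ, ‖(n : ℂ) ^ (((t : ℝ) : ℂ) * I)‖ ≤ 1 :=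
    Halasz.Restricted.norm_natCast_cpow_le_one_of_re_eq_zero (by simp)
  have h1b : ∀ n : ℕ, ‖(1 : ℕ → ℂ) n‖ ≤ 1 := fun n => by simp
  have hf0 : ∀ p : ℕ, 0 ≤ f p := fun p => by
    have h := Sieve.pretentiousDistSq_summand_nonneg h1b hτ p
    simpa only [Pi.one_apply, one_mul, Complex.conj_re] using h
  have hsum : ∀ z : ℝ, pretentiousDistSq 1 (fun n : ℕ => (n : ℂ) ^ ((t : ℂ) * I)) z =
      ∑ p ∈ Nat.primesLE ⌊z⌋₊, f p := fun z => by
    unfold pretentiousDistSq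
    refine Finset.sum_congr rfl fun p _ => ?_
    simp only [Pi.one_apply, one_mul, Complex.conj_re, hf]
  rw [hsum, hsum]
  have hsub : Nat.primesLE ⌊P - 1⌋₊ ⊆ Nat.primesLE ⌊Y⌋₊ := by
    intro p hp
    rw [Nat.mem_primesLE] at hp ⊢
    exact ⟨hp.1.trans (Nat.floor_le_floor (by linarith)), hp.2⟩
  rw [← Finset.sum_sdiff hsub, add_sub_cancel_right]
  refine Finset.sum_le_sum_of_subset_of_nonneg (fun p hp => ?_) (fun p _ _ => hf0 p)
  rw [Finset.mem_filter, Finset.mem_Icc] at hp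
  rw [Finset.mem_sdiff, Nat.mem_primesLE, Nat.mem_primesLE]
  refine ⟨⟨hp.1.2, hp.2⟩, fun h => ?_⟩
  have h1 : (p : ℝ) ≤ P - 1 := (Nat.le_floor_iff hP10).1 h.1
  have h2 : P ≤ p := Nat.ceil_le.1 hp.1.1
  linarith

end ZetaScale

end Literature.NumberTheory.LFunctions
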